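/-
Copyright (c) 2026 the pub-hodgecm-mathlib formalisation cell (harness21).  Prover seat hodgecm-mathlib-K2E3-p03 (g9), Track B «K2-LIT» ∕ h413
(`stmt-HodgeConjecture-24833`), line `K2_E3_EllipticInputs`, unit U4 «Keys», cell «U4-RAM» (deal D171), PART «U4Keys» socket :155
`sig_K2E3KeysThmTwoContractingRamifiedCharOneDepthZeroNormTrivial` (depth 0, Branch B), plan step Z3-c (the Casselman pair), brick (II)-b1 «THE SIGN `ε₀` AND THE DEPTH-ZERO LETTERS».
2026-09-04.
-/
import Summits.HodgeConjecture.HodgeConjecture.Theorems.K2E3KeysThmTwoDepthZeroBranchBConversion   -- ★ Z5 p861418 (K2E3-p32 (g0)): `apply_eq_one_of_branchB_of_fixed` (Branch B ⟹ `χ₁ = 1` on σ-fixed unit-integers); brings ★ `mem_unitsIntegers_iff`, ★ `valued_conjLocal_apply_of_smul_eq`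
import Literature.NumberTheory.Automorphic.NonsplitPlaceHaarBallRatios                            -- ★ L-β0: the σ-fixed uniformiser unit; brings ★ `HeisRing.map_units_inv_of_antifixed` (`InvolutionRingFixedDecomposition`)
import HarnessLib

/-!
# K2 ∕ E3 «EllipticInputs», unit U4 «Keys» — socket :155 (depth 0, Branch B), step Z3-c, brick (II)-b1: THE SIGN `ε₀ = χ₁(δ₀) = ±1` OF A SKEW UNIT AND THE
# DEPTH-ZERO ∕ BRANCH-B LETTERS OF `χ₁` ON THE UNITS OF `L ⊗ L⁺_v`

Cell hodgecm-mathlib (D-0151), FLOOR 0, Track B «K2-LIT», engine E3, crux item H413 = stmt-HodgeConjecture-24833 (route `HCCMUnconditional`, no route verbs); target BY NAME the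
OPEN socket `…U4Keys.sig_K2E3KeysThmTwoContractingRamifiedCharOneDepthZeroNormTrivial` (:155; BRANCH B of design D-I v2 of K2E3-p06 (g4), `PAPER-Z3-DepthZeroInert` §1 «KEY CHARACTER
SUM», the sign `ε₀ := λ̄(δ̄₀) = ±1`).  Author K2E3-p03 (g9) (cell «U4-RAM»; shared frame `K2/K2E3-p03/g9/Z3c-frame.v1.txt` §(II)-b1).  `--supports stmt-HodgeConjecture-24833 --as helper`;
THEOREMS ONLY (no `def`, no `instance`, no notation, no named-fact hypothesis, no `sorry`).  NOT THE PAYER.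

THE POINT.  At a NON-SPLIT UNRAMIFIED place `v` (`w ∣ v`, `c • w = w`), a character `χ₁` of `(L ⊗ L⁺_v)ˣ` of DEPTH ZERO (`hdepth`: trivial on the principal units) in BRANCH B (`hB`:
`χ₁(u · σu) = 1` on the units of absolute value `1`) is trivial on the `σ`-FIXED units of absolute value `1` (★ p32 `apply_eq_one_of_branchB_of_fixed`, via ★ p05's «σ-fixed units are norms»), hence
takes ONE value `ε₀ = χ₁(δ₀)` on ALL the `σ`-SKEW units `δ` of absolute value `1` (`δ∕δ₀` is fixed), with `ε₀² = χ₁(δ₀²) = 1`; and `χ₁((σu)⁻¹) = χ₁(u)`, `χ₁(−1) = 1`, and `χ₁(u) = χ₁(u′)` as soon as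
`|u_w − u′_w|_w < 1 = |u_w|_w` (depth zero).  These are the letters by which the shell integrals of the Casselman pair (`PAPER-Z3` §1: `λ̄(ȳδ̄₀) = ε₀`, `λ̄(−1) = 1`, «`λ̄` trivial on `𝔽_qˣ`»,
«the integrand depends on `z mod 𝔭` only») are read in the sequel bricks (II)-a (K2E3-p26 (g2)) ∕ (II)-b2 (R90-C10-p04 (g0)) ∕ (II)-b3 (this seat).
* §1 `valued_units_inv_apply` (`|u⁻¹_w| = |u_w|⁻¹`-bookkeeping), **`apply_eq_of_valued_sub_lt_one`** (depth-zero congruence).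
* §2 **`apply_neg_one_eq_one`**, **`apply_inv_map_eq`** (`χ₁((σu)⁻¹) = χ₁ u`), **`apply_skew_unit_eq`** (`χ₁ δ = χ₁ δ₀`), **`apply_skew_unit_sq`** ∕ **`coe_apply_skew_unit_sq`** (`ε₀² = 1`).

HONEST LABEL: HC_CM is proved only modulo the 7 printed citations (2 remaining named inputs: hLiu418 = stmt-HodgeConjecture-24832, h413 = stmt-HodgeConjecture-24833)
until rung 0 closes; count-neutral — this file does NOT pay the socket; no printed citation is discharged.

## References
* [Keys1984] D. Keys, *Principal series representations of special unitary groups over local fields*, Compositio Math. 51 (1984), §3, §7 Theorem (2) p. 126.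
* [Rogawski1990] J. Rogawski, *Automorphic representations of unitary groups in three variables*, Ann. of Math. Stud. 123 (1990), §12.1 p. 171, §12.2 (2) p. 173.
* [MoyPrasad1996] A. Moy, G. Prasad, *Jacquet functors and unrefined minimal K-types*, Comment. Math. Helv. 71 (1996), §3 (depth zero).
* [NeukirchANT1999] J. Neukirch, *Algebraic Number Theory* (1999), Ch. II §6 (units and principal units of a local field).
-/

set_option autoImplicit false
-- the mandated namespace has the single-problem summit's repeated segment (`HodgeConjecture.HodgeConjecture`)
set_option linter.dupNamespace false

noncomputable section

open NumberField IsDedekindDomain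
open scoped WithZero Valued
open Literature.NumberTheory Literature.NumberTheory.Automorphic Literature.NumberTheory.Automorphic.UnitaryGroup

namespace Summit.HodgeConjecture.HodgeConjecture.Cruxes.H413.K2E3BranchBSkewUnitSign

open Summit.HodgeConjecture.HodgeConjecture.Cruxes.H413

variable (L : Type) [Field L] [NumberField L] [IsCMField L] (v : HeightOneSpectrum (𝓞 ↥(maximalRealSubfield L)))
  (w : PlacesOver L v) (hw : IsCMField.complexConj L • w.1 = w.1)

/-! ## §1 Valuation bookkeeping at the single place `w ∣ v`; the depth-zero congruence -/

include hw in
/-- At a non-split `v` every place over `v` is `w`, so a hypothesis at `w` holds at every `w′ ∣ v`. [cite: NeukirchANT1999, Ch. II §6] -/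
theorem forall_placesOver_of_apply {P : PlacesOver L v → Prop} (h : P w) : ∀ w' : PlacesOver L v, P w' := fun w' => by
  haveI : Algebra.IsQuadraticExtension ↥(maximalRealSubfield L) L := IsCMField.isQuadraticExtension L
  rw [PlacesOver.eq_of_smul_eq (IsCMField.complexConj L) (IsCMField.complexConj_ne_one L) w hw w']; exact h

omit [IsCMField L] in
/-- `u_w · (u⁻¹)_w = 1` for a unit `u` of `L ⊗ L⁺_v`. [cite: NeukirchANT1999, Ch. II §6] -/
theorem units_apply_mul_inv_apply (u : (LocalRing L v)ˣ) (w' : PlacesOver L v) :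
    (u : LocalRing L v) w' * ((u⁻¹ : (LocalRing L v)ˣ) : LocalRing L v) w' = 1 := by
  rw [← Pi.mul_apply, Units.mul_inv]; rfl

omit [IsCMField L] in
/-- `|(u⁻¹)_w| = 1` when `|u_w| = 1`. [cite: NeukirchANT1999, Ch. II §6] -/
theorem valued_units_inv_apply_eq_one {u : (LocalRing L v)ˣ} {w' : PlacesOver L v} (hu : Valued.v ((u : LocalRing L v) w') = 1) :
    Valued.v (((u⁻¹ : (LocalRing L v)ˣ) : LocalRing L v) w') = 1 := by
  have h := congrArg Valued.v (units_apply_mul_inv_apply L v u w')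
  rw [map_mul, map_one, hu, one_mul] at h
  exact h

include hw in
/-- **DEPTH-ZERO CONGRUENCE**: for `χ₁` trivial on the principal units, `χ₁ u = χ₁ u′` whenever `|u_w| = 1` and `|u_w − u′_w| < 1` (`u′u⁻¹` is a principal unit) — «the integrand depends
on `z mod 𝔭` only» in `PAPER-Z3` §1. [cite: MoyPrasad1996, §3] [cite: Keys1984, §7] -/
theorem apply_eq_of_valued_sub_lt_one (χ₁ : (LocalRing L v)ˣ →* ℂˣ)
    (hdepth : ∀ u : (LocalRing L v)ˣ, (∀ w' : PlacesOver L v, Valued.v (((u : LocalRing L v) w') - 1) < 1) → χ₁ u = 1)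
    (u u' : (LocalRing L v)ˣ) (hu : Valued.v ((u : LocalRing L v) w) = 1) (h : Valued.v (((u : LocalRing L v) - u') w) < 1) :
    χ₁ u = χ₁ u' := by
  have hr : χ₁ (u' * u⁻¹) = 1 := by
    refine hdepth _ (forall_placesOver_of_apply L v w hw ?_)
    have hcalc : (((u' * u⁻¹ : (LocalRing L v)ˣ) : LocalRing L v) w) - 1 =
        (((u' : LocalRing L v) - u) w) * ((u⁻¹ : (LocalRing L v)ˣ) : LocalRing L v) w := by
      rw [Units.val_mul, Pi.mul_apply, Pi.sub_apply, ← units_apply_mul_inv_apply L v u w]; ring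
    rw [hcalc, map_mul, valued_units_inv_apply_eq_one L v hu, mul_one, Pi.sub_apply, Valuation.map_sub_swap, ← Pi.sub_apply]
    exact h
  calc χ₁ u = χ₁ (u' * u⁻¹) * χ₁ u := by rw [hr, one_mul]
    _ = χ₁ u' := by rw [← map_mul, inv_mul_cancel_right]

/-! ## §2 Branch B: `χ₁(−1) = 1`, `χ₁((σu)⁻¹) = χ₁(u)`, the sign `ε₀` of the skew units -/

section BranchB

variable (hunr : Algebra.IsUnramifiedIn (𝓞 L) v.asIdeal) (χ₁ : (LocalRing L v)ˣ →* ℂˣ)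
  (hB : ∀ u : (LocalRing L v)ˣ, (∀ w' : PlacesOver L v, Valued.v ((u : LocalRing L v) w') = 1) →
    χ₁ (u * Units.map (conjLocal L (IsCMField.complexConj L) v : LocalRing L v →* LocalRing L v) u) = 1)

include hw hunr hB in
/-- **Branch B kills the `σ`-fixed units of absolute value `1`** (★ p32 `apply_eq_one_of_branchB_of_fixed`, hypotheses read at the single place `w`). [cite: Keys1984, §7 Theorem (2) p. 126]
[cite: Rogawski1990, §12.2 (2) p. 173] -/
theorem apply_eq_one_of_fixed (x : (LocalRing L v)ˣ) (hx : Valued.v ((x : LocalRing L v) w) = 1)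
    (hσx : conjLocal L (IsCMField.complexConj L) v (x : LocalRing L v) = x) : χ₁ x = 1 :=
  K2E3KeysThmTwoDepthZeroBranchBConversion.apply_eq_one_of_branchB_of_fixed L v (forall_placesOver_of_apply L v w hw hw) hunr χ₁ hB x
    ((F0P3cStCharTSTorusCompactPart.mem_unitsIntegers_iff L v x).2 (forall_placesOver_of_apply L v w hw hx)) hσx

include hw hunr hB in
/-- **`χ₁(−1) = 1`** (`−1` is a `σ`-fixed unit). [cite: Keys1984, §7] -/
theorem apply_neg_one_eq_one : χ₁ (-1) = 1 :=
  apply_eq_one_of_fixed L v w hw hunr χ₁ hB (-1) (by rw [Units.val_neg, Units.val_one, Pi.neg_apply, Pi.one_apply, Valuation.map_neg, map_one])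
    (by rw [Units.val_neg, Units.val_one, map_neg, map_one])

include hw hB in
/-- **`χ₁((σu)⁻¹) = χ₁(u)`** for a unit with `|u_w| = 1` (`χ₁(u · σu) = 1`). [cite: Keys1984, §7 Theorem (2) p. 126] [cite: Rogawski1990, §12.2 (2) p. 173] -/
theorem apply_inv_map_eq (u : (LocalRing L v)ˣ) (hu : Valued.v ((u : LocalRing L v) w) = 1) :
    χ₁ (Units.map (conjLocal L (IsCMField.complexConj L) v : LocalRing L v →* LocalRing L v) u)⁻¹ = χ₁ u := by
  have h := hB u (forall_placesOver_of_apply L v w hw hu)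
  rw [map_mul, mul_eq_one_iff_inv_eq] at h
  rw [map_inv, ← h, inv_inv]

variable (δ₀ : (LocalRing L v)ˣ) (hδσ : conjLocal L (IsCMField.complexConj L) v (δ₀ : LocalRing L v) = -(δ₀ : LocalRing L v))
  (hδv : Valued.v ((δ₀ : LocalRing L v) w) = 1)

include hw hunr hB hδσ hδv in
/-- **All skew units of absolute value `1` have the same `χ₁`-value `ε₀ = χ₁(δ₀)`**: `δ · δ₀⁻¹` is a `σ`-fixed unit of absolute value `1` (★ `HeisRing.map_units_inv_of_antifixed`), killed by
Branch B — the `λ̄(ȳ′δ̄₀) = λ̄(δ̄₀) = ε₀` of `PAPER-Z3` §1. [cite: Keys1984, §7 Theorem (2) p. 126] [cite: Rogawski1990, §12.2 (2) p. 173] -/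
theorem apply_skew_unit_eq (δ : (LocalRing L v)ˣ) (hδ : conjLocal L (IsCMField.complexConj L) v (δ : LocalRing L v) = -(δ : LocalRing L v))
    (hv : Valued.v ((δ : LocalRing L v) w) = 1) : χ₁ δ = χ₁ δ₀ := by
  have hfix : conjLocal L (IsCMField.complexConj L) v ((δ * δ₀⁻¹ : (LocalRing L v)ˣ) : LocalRing L v) = (δ * δ₀⁻¹ : (LocalRing L v)ˣ) := by
    rw [Units.val_mul, map_mul, hδ, HeisRing.map_units_inv_of_antifixed (conjLocal L (IsCMField.complexConj L) v) δ₀ hδσ, neg_mul_neg]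
  have hval : Valued.v (((δ * δ₀⁻¹ : (LocalRing L v)ˣ) : LocalRing L v) w) = 1 := by
    rw [Units.val_mul, Pi.mul_apply, map_mul, hv, valued_units_inv_apply_eq_one L v hδv, one_mul]
  have h := apply_eq_one_of_fixed L v w hw hunr χ₁ hB _ hval hfix
  rw [map_mul, map_inv, mul_inv_eq_one] at h
  exact h

include hw hunr hB hδσ hδv in
/-- **`ε₀² = 1`**: `δ₀²` is a `σ`-fixed unit of absolute value `1`. [cite: Keys1984, §7 Theorem (2) p. 126] -/
theorem apply_skew_unit_sq : χ₁ δ₀ ^ 2 = 1 := by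
  rw [← map_pow]
  refine apply_eq_one_of_fixed L v w hw hunr χ₁ hB _ ?_ ?_
  · rw [Units.val_pow_eq_pow_val, Pi.pow_apply, map_pow, hδv, one_pow]
  · rw [Units.val_pow_eq_pow_val, map_pow, hδσ, neg_sq]

include hw hunr hB hδσ hδv in
/-- `ε₀² = 1` read in `ℂ`: `((χ₁ δ₀ : ℂˣ) : ℂ) ^ 2 = 1`, so `ε₀ = ±1` and `ε₀⁻¹ = ε₀`. [cite: Keys1984, §7 Theorem (2) p. 126] -/
theorem coe_apply_skew_unit_sq : ((χ₁ δ₀ : ℂˣ) : ℂ) ^ 2 = 1 := by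
  rw [← Units.val_pow_eq_pow_val, apply_skew_unit_sq L v w hw hunr χ₁ hB δ₀ hδσ hδv, Units.val_one]

include hw hunr hB hδσ hδv in
/-- `ε₀⁻¹ = ε₀` in `ℂ`. [cite: Keys1984, §7 Theorem (2) p. 126] -/
theorem coe_apply_skew_unit_inv : (((χ₁ δ₀)⁻¹ : ℂˣ) : ℂ) = ((χ₁ δ₀ : ℂˣ) : ℂ) := by
  have h := apply_skew_unit_sq L v w hw hunr χ₁ hB δ₀ hδσ hδv
  rw [pow_two, mul_eq_one_iff_inv_eq] at h
  rw [h]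

end BranchB

end Summit.HodgeConjecture.HodgeConjecture.Cruxes.H413.K2E3BranchBSkewUnitSign

end
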